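import Summits.QuantumFields.BalabanUV.T4Continuum.Support.VariationalVectorGaugeSliceDist

/-!
# T⁴ programme, spine node NE2 (U1a), lane P2 — «V-AVG-G», file 3: THE DECOMPOSITION OF (G″) — Bałaban's projected functional of a coarse field is below
# ONE commutator (DIV-AVG) + the block mean of ANY fine 0-form read at distance (Jensen, coefficient one) + ONE harmonic-approximation distance (HARM↓)
# (abstract `projG` ∕ `sliceSub` letters; model level; cell `pub-balaban`)

NE2 formalisation swarm `b2b-balaban-t4-ne2-formalise-*`, leaf prover 10 GEN 4 (`prover-b2b-balaban-t4-ne2-formalise-leaf-10-g4-0`, V-END holder lineage); journal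
INTENT «V-AVG-G: THE LOWER BRACKET WITHOUT A SLICE MOVE» CLAIMS.log 2026-08-20 18:22Z l.19093, file 3.  On top of leaf-09-g7's `VariationalVectorGaugeSlice` (p221888:
`projG`, `sliceSub`, `norm_toLp_sq`), leaf-01-g8's `VariationalVectorGaugeSliceDist` (p229806: `projG_le_norm_sub_sq`, `norm_toLp_sub_sq`), the scalar road's transported block
mean `VariationalColourFederbush.Qcv` (p215201) and [B5]'s block bijection `B5AverageCurlStokes.sum_blocks_real` BY NAME; nothing defined.

THE POINT.  File 1 (`VariationalVectorLowerAvgG`) reduced the LOWER bracket of the vector END to the curl Federbush at `G := 0` and ONE displayed law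
  (G″)  `(n^d)⁻¹(n²·G (Q₁ g₀)) ≤ (√(((nL)^d)⁻¹((nL)²·G′ g₀)) + ε″·√(ρ′ g₀))²`
at fine minimisers.  For Bałaban's projected functional `G = projG R K = ‖Π_{S_R(K)} div_R ·‖² = dist²_{ℓ²}(div_R ·, S_R(K)ᗮ)` (p229806 §1) the law is a TRIANGLE
INEQUALITY with three legs, none of which moves any field:
  `√(projG R K W) ≤ ‖div_R W − L•Q₀ D′‖ + ‖L•Q₀(D′ − h′)‖ + ‖L•Q₀ h′ − u‖`      for ANY fine 0-forms `D′, h′` and ANY `u ∈ S_R(K)ᗮ`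
(think `W = Q₁ g₀` the pushed-down fine minimiser, `D′ = div_{R′} g₀`, `h′ = Π_{S′ᗮ} D′` its fine slice representative — so that `‖D′ − h′‖² = projG′ g₀` by
`projG_eq_norm_sub_sq` — and `u` a coarse `K`-harmonic 0-form near the pushed-down `h′`), and the middle leg is JENSEN for the transported block mean `Q₀ = Qcv L N T₀′`
with contractive site transports: `Σ_y‖Q₀ f y‖² ≤ L^{−d}·Σ_x‖f x‖²` (§1), so that `‖L•Q₀(D′ − h′)‖ ≤ L^{1−d∕2}·‖D′ − h′‖` and, after the END's normalisations
`√((n^d)⁻¹n²)·L^{1−d∕2} = √(((nL)^d)⁻¹(nL)²)`, the fine functional enters WITH COEFFICIENT ONE (§3) — the reason the (G″) route has no multiplicative `σ`-type constant.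
 * §1 **`sum_norm_sq_Qcv_le`** (Jensen), `norm_toLp_smul_Qcv_le` (`‖toLp(c•Q₀ f)‖ ≤ ‖c‖·√(L^{−d})·‖toLp f‖`).
 * §2 **`sqrt_projG_le_three_legs`** (the triangle inequality above, lattice units).
 * §3 **`sqrt_projG_norm_le_three_legs`** (END units, `N := fine n M`: `√((n^d)⁻¹(n²·projG R K W)) ≤ √(((nL)^d)⁻¹((nL)²·‖D′ − h′‖²)) + √((n^d)⁻¹n²)·(DIV + HARM)`)
   and **`avgG_of_legs`** — the (G″) SOCKET SHAPE of file 1 ∕ file 2 (`hAVGG`) from two DISPLAYED leg bounds: DIV-AVG `√((n^d)⁻¹n²)·‖div_R W − L•Q₀ D′‖ ≤ ε_D·√ρ_D`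
   and HARM↓ `√((n^d)⁻¹n²)·‖L•Q₀ h′ − u‖ ≤ ε_H·√ρ_H` for some `u ∈ S_R(K)ᗮ`, and the supplier's identification `((nL)^d)⁻¹((nL)²·‖D′ − h′‖²) ≤ Gf` of the fine
   functional: `(n^d)⁻¹(n²·projG R K W) ≤ (√Gf + (ε_D + ε_H)·√(ρ_D + ρ_H))²`.
WHAT IS NOT HERE: the two legs themselves.  DIV-AVG (the commutator of the covariant divergence with the line average against the scalar block mean, on regular
fields — the twin of leaf-01-g8's DIV-INTERP) and HARM↓ (the block mean of a fine `K′`-harmonic 0-form is close to a coarse `K`-harmonic one — the dual of leaf-01-g8's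
`VariationalHarmonicApprox`, from the scalar road's brackets + Pythagoras on the COARSE scalar fibre) are the next files of this item; both are expected FIRST order in
the small quantities (lattice-spacing consistency), with NO level-independent part.

HONEST FRAMING (T4-DAG p. 1).  Abstract Hilbert-space bookkeeping + Jensen at MODEL level (transports `R`, site transports `T₀′`, the submodule `K` DATA; c5 — no
identification with Bałaban's `R_k(U)`); [folklore]; nothing printed is a hypothesis; no `def`, no `def … : Prop`, no `sorry`; axioms standard.  (G″) with background NOT
proved here (its two legs are DISPLAYED); V-END with background ∕ NE2 NOT proved; NE3 OPEN; spine PROVED 0∕9 unchanged; rung (B)+1 on a fixed finite T⁴ — NOT infinite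
volume, NOT mass gap, NOT Clay.  HONEST DEPENDENCY (cell, verbatim): continuum YM on T⁴ ⇐ BetaPertH ∧ nine spine estimates (0/9 proved); BetaPertH ⇐ (D1) ∧ (D4) ∧
CAP+tail; G-an2-4 gates asym, D1 and NE2/3/4.
-/

noncomputable section

namespace Summit.QuantumFields.BalabanUV.T4Continuum.VariationalVectorAvgGDecomposition

open Finset WithLp
open scoped InnerProductSpace
open Literature.MathematicalPhysics.QuantumFieldTheory.Balaban1983to89.B5Prop11Plancherel (Tor fine unitVec)
open Literature.MathematicalPhysics.QuantumFieldTheory.Balaban1983to89.B5Block118 (bpt)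
open Literature.MathematicalPhysics.QuantumFieldTheory.Balaban1983to89.B5AverageCurlStokes (sum_blocks_real)
open Summit.QuantumFields.BalabanUV.T4Continuum.VariationalCovariantFederbush (sq_sum_le_card_mul)
open Summit.QuantumFields.BalabanUV.T4Continuum.VariationalColourFederbush (Qcv)
open Summit.QuantumFields.BalabanUV.T4Continuum.VariationalVectorWeitzenbock (divV)
open Summit.QuantumFields.BalabanUV.T4Continuum.VariationalVectorGaugeSlice (sliceSub projG projG_nonneg norm_toLp_sq)
open Summit.QuantumFields.BalabanUV.T4Continuum.VariationalVectorGaugeSliceDist (projG_le_norm_sub_sq norm_toLp_sub_sq)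

variable {d : ℕ} {E : Type*} [NormedAddCommGroup E]

/-! ## §1 Jensen for the transported block mean -/

section Jensen

variable [NormedSpace ℂ E] (L : ℕ) [NeZero L] (N : Fin d → ℕ) [∀ μ, NeZero (N μ)]

omit [NeZero L] [∀ μ, NeZero (N μ)] in
/-- **JENSEN, POINTWISE**: `‖Q₀ f y‖ ≤ L^{−d}·Σ_j ‖f(bpt y j)‖` for contractive site transports. [folklore] -/
theorem norm_Qcv_le {T' : Tor (fine L N) → (E →L[ℂ] E)} (hT' : ∀ x, ‖T' x‖ ≤ 1) (f : Tor (fine L N) → E) (y : Tor N) :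
    ‖Qcv L N T' f y‖ ≤ ((L : ℝ) ^ d)⁻¹ * ∑ j : Fin d → Fin L, ‖f (bpt L N y j)‖ := by
  unfold Qcv
  have hc : ‖(((L : ℂ) ^ d)⁻¹ : ℂ)‖ = ((L : ℝ) ^ d)⁻¹ := by
    rw [norm_inv, norm_pow, Complex.norm_natCast]
  rw [norm_smul, hc]
  refine mul_le_mul_of_nonneg_left ((norm_sum_le _ _).trans (sum_le_sum fun j _ => ?_)) (by positivity)
  calc ‖T' (bpt L N y j) (f (bpt L N y j))‖ ≤ ‖T' (bpt L N y j)‖ * ‖f (bpt L N y j)‖ := ContinuousLinearMap.le_opNorm _ _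
    _ ≤ 1 * ‖f (bpt L N y j)‖ := mul_le_mul_of_nonneg_right (hT' _) (norm_nonneg _)
    _ = ‖f (bpt L N y j)‖ := one_mul _

/-- **JENSEN FOR THE TRANSPORTED BLOCK MEAN**: `Σ_y ‖Q₀ f y‖² ≤ L^{−d}·Σ_x ‖f x‖²` for contractive site transports (Cauchy–Schwarz over the `L^d` points of a block
and [B5]'s block bijection (1.6)). [folklore] -/
theorem sum_norm_sq_Qcv_le {T' : Tor (fine L N) → (E →L[ℂ] E)} (hT' : ∀ x, ‖T' x‖ ≤ 1) (f : Tor (fine L N) → E) :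
    ∑ y, ‖Qcv L N T' f y‖ ^ 2 ≤ ((L : ℝ) ^ d)⁻¹ * ∑ x, ‖f x‖ ^ 2 := by
  have hL : (0 : ℝ) < (L : ℝ) ^ d := by have := Nat.pos_of_ne_zero (NeZero.ne L); positivity
  -- Cauchy–Schwarz per block
  have hcs : ∀ y : Tor N, (∑ j : Fin d → Fin L, ‖f (bpt L N y j)‖) ^ 2 ≤ (L : ℝ) ^ d * ∑ j : Fin d → Fin L, ‖f (bpt L N y j)‖ ^ 2 := fun y => by
    have h := sq_sum_le_card_mul Finset.univ (fun j : Fin d → Fin L => ‖f (bpt L N y j)‖)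
    rwa [Finset.card_univ, Fintype.card_fun, Fintype.card_fin, Fintype.card_fin, Nat.cast_pow] at h
  calc ∑ y, ‖Qcv L N T' f y‖ ^ 2 ≤ ∑ y : Tor N, (((L : ℝ) ^ d)⁻¹ * ∑ j : Fin d → Fin L, ‖f (bpt L N y j)‖) ^ 2 :=
        sum_le_sum fun y _ => pow_le_pow_left₀ (norm_nonneg _) (norm_Qcv_le L N hT' f y) 2
    _ ≤ ∑ y : Tor N, (((L : ℝ) ^ d)⁻¹) ^ 2 * ((L : ℝ) ^ d * ∑ j : Fin d → Fin L, ‖f (bpt L N y j)‖ ^ 2) := by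
        refine sum_le_sum fun y _ => ?_
        rw [mul_pow]
        exact mul_le_mul_of_nonneg_left (hcs y) (sq_nonneg _)
    _ = ((L : ℝ) ^ d)⁻¹ * ∑ y : Tor N, ∑ j : Fin d → Fin L, ‖f (bpt L N y j)‖ ^ 2 := by
        rw [← mul_sum, ← mul_sum]; field_simp
    _ = ((L : ℝ) ^ d)⁻¹ * ∑ x, ‖f x‖ ^ 2 := by rw [← sum_blocks_real L N (fun x => ‖f x‖ ^ 2)]

/-- **JENSEN IN `ℓ²`**: `‖toLp(c • Q₀ f)‖ ≤ ‖c‖·√(L^{−d})·‖toLp f‖`. [folklore] -/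
theorem norm_toLp_smul_Qcv_le {T' : Tor (fine L N) → (E →L[ℂ] E)} (hT' : ∀ x, ‖T' x‖ ≤ 1) (c : ℂ) (f : Tor (fine L N) → E) :
    ‖toLp 2 (fun y => c • Qcv L N T' f y)‖ ≤ ‖c‖ * Real.sqrt (((L : ℝ) ^ d)⁻¹) * ‖toLp 2 f‖ := by
  have h0 : 0 ≤ ‖c‖ * Real.sqrt (((L : ℝ) ^ d)⁻¹) * ‖toLp 2 f‖ := by positivity
  rw [← Real.sqrt_sq (norm_nonneg (toLp 2 (fun y => c • Qcv L N T' f y))), ← Real.sqrt_sq h0]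
  refine Real.sqrt_le_sqrt ?_
  rw [norm_toLp_sq, mul_pow, mul_pow, Real.sq_sqrt (by positivity), norm_toLp_sq]
  calc ∑ y, ‖c • Qcv L N T' f y‖ ^ 2 = ‖c‖ ^ 2 * ∑ y, ‖Qcv L N T' f y‖ ^ 2 := by
        simp only [norm_smul, mul_pow, mul_sum]
    _ ≤ ‖c‖ ^ 2 * (((L : ℝ) ^ d)⁻¹ * ∑ x, ‖f x‖ ^ 2) := mul_le_mul_of_nonneg_left (sum_norm_sq_Qcv_le L N hT' f) (sq_nonneg _)
    _ = ‖c‖ ^ 2 * ((L : ℝ) ^ d)⁻¹ * ∑ x, ‖f x‖ ^ 2 := by ring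

end Jensen

/-! ## §2 The three legs (lattice units) -/

section Legs

variable [InnerProductSpace ℂ E] [CompleteSpace E] [FiniteDimensional ℂ E]
variable (L : ℕ) [NeZero L] (N : Fin d → ℕ) [∀ μ, NeZero (N μ)]

omit [NeZero L] in
/-- **`√projG` IS BELOW THREE LEGS**: for ANY coarse 1-form `W`, ANY fine 0-forms `D′, h′`, ANY `u ∈ S_R(K)ᗮ` and ANY scalar `c`:
`√(projG R K W) ≤ ‖toLp(div_R W) − toLp(c•Q₀ D′)‖ + ‖toLp(c•Q₀ D′) − toLp(c•Q₀ h′)‖ + ‖toLp(c•Q₀ h′) − toLp u‖` — `projG` is the squared distance to `S_R(K)ᗮ`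
(p229806 §1) and the triangle inequality. [folklore] -/
theorem sqrt_projG_le_three_legs (R : Tor N → Fin d → (E →L[ℂ] E)) (K : Submodule ℂ (Tor N → E)) (W : Tor N → Fin d → E)
    (T' : Tor (fine L N) → (E →L[ℂ] E)) (c : ℂ) (D' h' : Tor (fine L N) → E) {u : Tor N → E} (hu : toLp 2 u ∈ (sliceSub N R K)ᗮ) :
    Real.sqrt (projG N R K W) ≤ ‖toLp 2 (divV N R W) - toLp 2 (fun y => c • Qcv L N T' D' y)‖
      + ‖toLp 2 (fun y => c • Qcv L N T' D' y) - toLp 2 (fun y => c • Qcv L N T' h' y)‖ + ‖toLp 2 (fun y => c • Qcv L N T' h' y) - toLp 2 u‖ := by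
  have h1 : Real.sqrt (projG N R K W) ≤ ‖toLp 2 (divV N R W) - toLp 2 u‖ := by
    rw [← Real.sqrt_sq (norm_nonneg (toLp 2 (divV N R W) - toLp 2 u))]
    exact Real.sqrt_le_sqrt (projG_le_norm_sub_sq N R K W hu)
  refine h1.trans ?_
  calc ‖toLp 2 (divV N R W) - toLp 2 u‖
      = ‖(toLp 2 (divV N R W) - toLp 2 (fun y => c • Qcv L N T' D' y)) + ((toLp 2 (fun y => c • Qcv L N T' D' y) - toLp 2 (fun y => c • Qcv L N T' h' y))
          + (toLp 2 (fun y => c • Qcv L N T' h' y) - toLp 2 u))‖ := by congr 1; abel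
    _ ≤ ‖toLp 2 (divV N R W) - toLp 2 (fun y => c • Qcv L N T' D' y)‖ + (‖toLp 2 (fun y => c • Qcv L N T' D' y) - toLp 2 (fun y => c • Qcv L N T' h' y)‖
          + ‖toLp 2 (fun y => c • Qcv L N T' h' y) - toLp 2 u‖) := (norm_add_le _ _).trans (add_le_add le_rfl (norm_add_le _ _))
    _ = _ := by ring

omit [CompleteSpace E] [FiniteDimensional ℂ E] in
/-- the middle leg is Jensen: `‖toLp(c•Q₀ D′) − toLp(c•Q₀ h′)‖ ≤ ‖c‖·√(L^{−d})·‖toLp D′ − toLp h′‖` (linearity of `Q₀` + §1). [folklore] -/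
theorem middle_leg_le {T' : Tor (fine L N) → (E →L[ℂ] E)} (hT' : ∀ x, ‖T' x‖ ≤ 1) (c : ℂ) (D' h' : Tor (fine L N) → E) :
    ‖toLp 2 (fun y => c • Qcv L N T' D' y) - toLp 2 (fun y => c • Qcv L N T' h' y)‖ ≤ ‖c‖ * Real.sqrt (((L : ℝ) ^ d)⁻¹) * ‖toLp 2 D' - toLp 2 h'‖ := by
  have hlin : (fun y => c • Qcv L N T' D' y) - (fun y => c • Qcv L N T' h' y) = fun y => c • Qcv L N T' (D' - h') y := by
    funext y
    simp only [Pi.sub_apply, Qcv, ← smul_sub, ← Finset.sum_sub_distrib, map_sub]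
  rw [← toLp_sub, hlin, ← toLp_sub]
  exact norm_toLp_smul_Qcv_le L N hT' c (D' - h')

end Legs

/-! ## §3 END units: the fine functional enters with coefficient ONE; the (G″) socket from two displayed legs -/

section EndUnits

variable [InnerProductSpace ℂ E] [CompleteSpace E] [FiniteDimensional ℂ E]
variable (n L : ℕ) [NeZero n] [NeZero L] (M : Fin d → ℕ) [hM : ∀ μ, NeZero (M μ)]

omit hM in
/-- the normalisation identity behind «coefficient one»: `√((n^d)⁻¹·n²)·(L·√(L^{−d})) = √(((nL)^d)⁻¹·(nL)²)`. [folklore] -/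
theorem sqrt_norm_mul_jensen : Real.sqrt (((n : ℝ) ^ d)⁻¹ * (n : ℝ) ^ 2) * ((L : ℝ) * Real.sqrt (((L : ℝ) ^ d)⁻¹))
    = Real.sqrt ((((n : ℝ) * L) ^ d)⁻¹ * ((n : ℝ) * L) ^ 2) := by
  have hn : (0 : ℝ) < n := by exact_mod_cast Nat.pos_of_ne_zero (NeZero.ne n)
  have hL : (0 : ℝ) < L := by exact_mod_cast Nat.pos_of_ne_zero (NeZero.ne L)
  have hL2 : (L : ℝ) = Real.sqrt ((L : ℝ) ^ 2) := (Real.sqrt_sq hL.le).symm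
  rw [hL2, ← Real.sqrt_mul (by positivity), ← Real.sqrt_mul (by positivity)]
  congr 1
  rw [← hL2, mul_pow, mul_pow, mul_inv]
  ring

/-- **`√projG` IN END UNITS, THREE LEGS, THE FINE LEG WITH COEFFICIENT ONE** (`N := fine n M`, `c := L`, contractive site transports): for any coarse 1-form `W`, fine
0-forms `D′, h′` and `u ∈ S_R(K)ᗮ`,
`√((n^d)⁻¹(n²·projG R K W)) ≤ √(((nL)^d)⁻¹((nL)²·‖toLp D′ − toLp h′‖²)) + √((n^d)⁻¹n²)·(‖toLp(div_R W) − toLp(L•Q₀ D′)‖ + ‖toLp(L•Q₀ h′) − toLp u‖)`. [folklore] -/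
theorem sqrt_projG_norm_le_three_legs (R : Tor (fine n M) → Fin d → (E →L[ℂ] E)) (K : Submodule ℂ (Tor (fine n M) → E)) (W : Tor (fine n M) → Fin d → E)
    {T' : Tor (fine L (fine n M)) → (E →L[ℂ] E)} (hT' : ∀ x, ‖T' x‖ ≤ 1) (D' h' : Tor (fine L (fine n M)) → E) {u : Tor (fine n M) → E}
    (hu : toLp 2 u ∈ (sliceSub (fine n M) R K)ᗮ) :
    Real.sqrt (((n : ℝ) ^ d)⁻¹ * ((n : ℝ) ^ 2 * projG (fine n M) R K W))
      ≤ Real.sqrt ((((n : ℝ) * L) ^ d)⁻¹ * (((n : ℝ) * L) ^ 2 * ‖toLp 2 D' - toLp 2 h'‖ ^ 2))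
        + Real.sqrt (((n : ℝ) ^ d)⁻¹ * (n : ℝ) ^ 2)
          * (‖toLp 2 (divV (fine n M) R W) - toLp 2 (fun y => (L : ℂ) • Qcv L (fine n M) T' D' y)‖
            + ‖toLp 2 (fun y => (L : ℂ) • Qcv L (fine n M) T' h' y) - toLp 2 u‖) := by
  have hν : 0 ≤ ((n : ℝ) ^ d)⁻¹ * (n : ℝ) ^ 2 := by positivity
  have hνL : 0 ≤ (((n : ℝ) * L) ^ d)⁻¹ * ((n : ℝ) * L) ^ 2 := by positivity
  have h3 := sqrt_projG_le_three_legs L (fine n M) R K W T' (L : ℂ) D' h' hu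
  have hm := middle_leg_le L (fine n M) hT' (L : ℂ) D' h'
  have hcL : ‖(L : ℂ)‖ = (L : ℝ) := Complex.norm_natCast L
  rw [hcL] at hm
  -- rescale the lattice-unit inequality by `√((n^d)⁻¹ n²)`
  have hlhs : Real.sqrt (((n : ℝ) ^ d)⁻¹ * ((n : ℝ) ^ 2 * projG (fine n M) R K W))
      = Real.sqrt (((n : ℝ) ^ d)⁻¹ * (n : ℝ) ^ 2) * Real.sqrt (projG (fine n M) R K W) := by
    rw [← mul_assoc, Real.sqrt_mul hν]
  have hfine : Real.sqrt ((((n : ℝ) * L) ^ d)⁻¹ * (((n : ℝ) * L) ^ 2 * ‖toLp 2 D' - toLp 2 h'‖ ^ 2))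
      = Real.sqrt ((((n : ℝ) * L) ^ d)⁻¹ * ((n : ℝ) * L) ^ 2) * ‖toLp 2 D' - toLp 2 h'‖ := by
    rw [← mul_assoc, Real.sqrt_mul hνL, Real.sqrt_sq (norm_nonneg _)]
  rw [hlhs, hfine, ← sqrt_norm_mul_jensen n L]
  have hs0 : 0 ≤ Real.sqrt (((n : ℝ) ^ d)⁻¹ * (n : ℝ) ^ 2) := Real.sqrt_nonneg _
  calc Real.sqrt (((n : ℝ) ^ d)⁻¹ * (n : ℝ) ^ 2) * Real.sqrt (projG (fine n M) R K W)
      ≤ Real.sqrt (((n : ℝ) ^ d)⁻¹ * (n : ℝ) ^ 2) * (‖toLp 2 (divV (fine n M) R W) - toLp 2 (fun y => (L : ℂ) • Qcv L (fine n M) T' D' y)‖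
          + (L : ℝ) * Real.sqrt (((L : ℝ) ^ d)⁻¹) * ‖toLp 2 D' - toLp 2 h'‖
          + ‖toLp 2 (fun y => (L : ℂ) • Qcv L (fine n M) T' h' y) - toLp 2 u‖) :=
        mul_le_mul_of_nonneg_left (h3.trans (by linarith)) hs0
    _ = _ := by ring

/-- `√(a·x) + √(b·y)... `: the two displayed legs under one square root — `ε_D√ρ_D + ε_H√ρ_H ≤ (ε_D + ε_H)·√(ρ_D + ρ_H)`. [folklore] -/
theorem legs_le_sum {εD εH ρD ρH : ℝ} (hεD : 0 ≤ εD) (hεH : 0 ≤ εH) (hρD : 0 ≤ ρD) (hρH : 0 ≤ ρH) :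
    εD * Real.sqrt ρD + εH * Real.sqrt ρH ≤ (εD + εH) * Real.sqrt (ρD + ρH) := by
  have h1 : Real.sqrt ρD ≤ Real.sqrt (ρD + ρH) := Real.sqrt_le_sqrt (by linarith)
  have h2 : Real.sqrt ρH ≤ Real.sqrt (ρD + ρH) := Real.sqrt_le_sqrt (by linarith)
  nlinarith [mul_le_mul_of_nonneg_left h1 hεD, mul_le_mul_of_nonneg_left h2 hεH]

/-- **THE (G″) SOCKET FROM TWO DISPLAYED LEGS** (the `hAVGG` shape of `VariationalVectorLowerAvgG` ∕ `VariationalVectorEndOfLeavesAvgG` for `G := projG R K`): if, at the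
coarse field `W` (think `W = Q₁ g₀`) with fine divergence datum `D′` and fine slice representative `h′` (think `D′ = div_{R′} g₀`, `h′ = Π_{S′ᗮ} D′`),
(DIV-AVG) `√((n^d)⁻¹n²)·‖toLp(div_R W) − toLp(L•Q₀ D′)‖ ≤ ε_D·√ρ_D`, (HARM↓) `√((n^d)⁻¹n²)·‖toLp(L•Q₀ h′) − toLp u‖ ≤ ε_H·√ρ_H` for some `u ∈ S_R(K)ᗮ`, and the
fine functional dominates the fine distance `((nL)^d)⁻¹((nL)²·‖toLp D′ − toLp h′‖²) ≤ Gf`, then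
`(n^d)⁻¹(n²·projG R K W) ≤ (√Gf + (ε_D + ε_H)·√(ρ_D + ρ_H))²`. [folklore] -/
theorem avgG_of_legs (R : Tor (fine n M) → Fin d → (E →L[ℂ] E)) (K : Submodule ℂ (Tor (fine n M) → E)) (W : Tor (fine n M) → Fin d → E)
    {T' : Tor (fine L (fine n M)) → (E →L[ℂ] E)} (hT' : ∀ x, ‖T' x‖ ≤ 1) (D' h' : Tor (fine L (fine n M)) → E) {u : Tor (fine n M) → E}
    (hu : toLp 2 u ∈ (sliceSub (fine n M) R K)ᗮ) {Gf εD εH ρD ρH : ℝ} (hεD : 0 ≤ εD) (hεH : 0 ≤ εH) (hρD : 0 ≤ ρD) (hρH : 0 ≤ ρH)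
    (hGf : (((n : ℝ) * L) ^ d)⁻¹ * (((n : ℝ) * L) ^ 2 * ‖toLp 2 D' - toLp 2 h'‖ ^ 2) ≤ Gf)
    (hDIV : Real.sqrt (((n : ℝ) ^ d)⁻¹ * (n : ℝ) ^ 2) * ‖toLp 2 (divV (fine n M) R W) - toLp 2 (fun y => (L : ℂ) • Qcv L (fine n M) T' D' y)‖
      ≤ εD * Real.sqrt ρD)
    (hHARM : Real.sqrt (((n : ℝ) ^ d)⁻¹ * (n : ℝ) ^ 2) * ‖toLp 2 (fun y => (L : ℂ) • Qcv L (fine n M) T' h' y) - toLp 2 u‖ ≤ εH * Real.sqrt ρH) :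
    ((n : ℝ) ^ d)⁻¹ * ((n : ℝ) ^ 2 * projG (fine n M) R K W) ≤ (Real.sqrt Gf + (εD + εH) * Real.sqrt (ρD + ρH)) ^ 2 := by
  have h3 := sqrt_projG_norm_le_three_legs n L M R K W hT' D' h' hu
  have hlegs := legs_le_sum hεD hεH hρD hρH
  have hG0 : 0 ≤ ((n : ℝ) ^ d)⁻¹ * ((n : ℝ) ^ 2 * projG (fine n M) R K W) := by have := projG_nonneg (fine n M) R K W; positivity
  have hfine : Real.sqrt ((((n : ℝ) * L) ^ d)⁻¹ * (((n : ℝ) * L) ^ 2 * ‖toLp 2 D' - toLp 2 h'‖ ^ 2)) ≤ Real.sqrt Gf := Real.sqrt_le_sqrt hGf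
  have hrhs0 : 0 ≤ Real.sqrt Gf + (εD + εH) * Real.sqrt (ρD + ρH) := by positivity
  have hle : Real.sqrt (((n : ℝ) ^ d)⁻¹ * ((n : ℝ) ^ 2 * projG (fine n M) R K W)) ≤ Real.sqrt Gf + (εD + εH) * Real.sqrt (ρD + ρH) := by
    refine h3.trans ?_
    rw [mul_add]
    linarith
  calc ((n : ℝ) ^ d)⁻¹ * ((n : ℝ) ^ 2 * projG (fine n M) R K W)
      = Real.sqrt (((n : ℝ) ^ d)⁻¹ * ((n : ℝ) ^ 2 * projG (fine n M) R K W)) ^ 2 := (Real.sq_sqrt hG0).symm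
    _ ≤ _ := pow_le_pow_left₀ (Real.sqrt_nonneg _) hle 2

end EndUnits

end Summit.QuantumFields.BalabanUV.T4Continuum.VariationalVectorAvgGDecomposition

end
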